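import Mathlib
import HarnessLib
import Summits.NavierStokesRegularity.NavierStokesRegularity.Theorems.HalfSpaceWindowDoorCirculationCarryingRigiditySourcedSwirlLiouville
import Summits.NavierStokesRegularity.NavierStokesRegularity.Theorems.HalfSpaceWindowDoorCirculationCarryingRigidityAxisCirculationDynamics
import Summits.NavierStokesRegularity.NavierStokesRegularity.Theorems.AxisTwistDoorAveragedConeLiouvilleFlatFlux
import Summits.NavierStokesRegularity.NavierStokesRegularity.Theorems.AxisTwistDoorAveragedConeLiouvilleShellBookkeeping
import Summits.NavierStokesRegularity.NavierStokesRegularity.Theorems.PoloidalWindowDoorPoloidalWindowRigidityFlat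

/-!
# Route `HalfSpaceWindowDoor`, crux `CirculationCarryingRigidity` (stmt-NavierStokesRegularity-25311) — CENSUS THEOREM
# «TILT-DOMINATED closed-hemisphere profiles of the SPACE–TIME Type-I subclass are trivial» (UNCONDITIONAL)

The first NON-LOCAL, sign-using stratum theorem on the open research stub `HemisphereLiouvilleE3` of crux 25311 (line
`extremal`'s census said: the maximum-principle family is exhausted, the residue needs a non-local ingredient).  For a profile
`v` of the door's Type-I ancient Oseen-mild class which moreover

* obeys the SPACE–TIME Type-I bound `‖v(t,x)‖ ≤ D/(‖x‖ + √(−t))` (`HasTypeIDecay D`, the subclass in which g0/g2 established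
  the finite conserved plane circulation), 
* is closed-hemisphere, `ω₃ = ⟪curl v, e₃⟫ ≥ 0`, and
* is TILT-DOMINATED about the vertical axis through the apex: `∮_{S(r,z)} |ω_h| dl ≤ K ∮_{S(r,z)} ω₃ dl` on every axis circle at
  every `s < 0` (AxisTwistDoor's slack-free circle-averaged cone `GlobalCone`),

the profile vanishes identically (`eq_zero_of_hasTypeIDecay_signE3_globalCone`); in particular it is poloidal and not backward
singular at the apex.  PROOF: the normalised axis circulation `F(s,x) = (2π)⁻¹ Γ(|x_h|, x₃, s)` (`…AxisCirculation`: smooth,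
axisymmetric, zero on the axis, `|F| ≤ D`, `∂ᵣF = (2π)⁻¹∮ω₃ ≥ 0`) solves, off the axis, LRT's circle law
`∂ₛF = ΔF − (2/r)∂ᵣF − (2π)⁻¹ T` (`…AxisCirculationDynamics.deriv_circ_s_eq`) whose circle term is, under the sign, the cone
and the space–time bound, an extra radial drift `(2π)⁻¹T = β ∂ᵣF` with `|β| ≤ (1+K)D/(r + √(−s))`; so `(F, 0, β)` is a
SOURCED SWIRL TRIPLE (`…Defs.IsSourcedSwirl`, `isSourcedSwirl_circF`) and the sourced swirl Liouville theorem
(`…SourcedSwirlLiouville`, KNSS 2009 Thm 5.3 + the tree's proved Lemma 2.1 + the new source estimate) gives `F ≡ 0`, i.e.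
`Γ ≡ 0`; AxisTwistDoor's `…FlatFlux.eq_zero_of_signE3_globalCone_circ_eq_zero` finishes.  CENSUS MEANING for 25311: the
stratum {space–time Type I} ∩ {tilt-dominated about the singular axis} is DEAD; survivors of `HemisphereLiouvilleE3` in the
subclass must TWIST about their axis (cf. AxisTwistDoor's research crux `TiltDominationLoc`, stmt-…-26991) — with no
`LeiRen2024`/`NazarovUraltseva2011` fact needed here.

Seat ns-hsw-p1 g3 (LEAD of 25311, cell pub-ns-dss).  WHAT THIS IS NOT: not a statement about Navier–Stokes regularity
(Clay A): a Liouville-type theorem about HYPOTHETICAL blow-up profiles; the crux, the stub and NS regularity remain OPEN;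
helper `--supports` 25311.
-/

noncomputable section

-- the summit and its single sub-problem share the name (CONVENTIONS §1), as in every Theorems file
set_option linter.dupNamespace false

namespace Summit.NavierStokesRegularity.NavierStokesRegularity.Theorems.HalfSpaceWindowDoorCirculationCarryingRigidityTiltDominatedLiouville

open MeasureTheory Set Function Filter Topology TopologicalSpace InnerProductSpace WithLp Metric
open scoped Laplacian RealInnerProductSpace ContDiff Classical
open Literature.Analysis Literature.Analysis.FluidPDE
open Summit.NavierStokesRegularity.NavierStokesRegularity.Theorems.HalfSpaceWindowDoorCirculationCarryingRigidityDefs (IsSourcedSwirl)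
open Summit.NavierStokesRegularity.NavierStokesRegularity.Theorems.AxisTwistDoorAveragedConeLiouvilleDefs
  (cylPt eT e3 circ vortCirc radVortCirc tiltCirc circleTerm SignE3 GlobalCone)
open Summit.NavierStokesRegularity.NavierStokesRegularity.Theorems.AveragedConeLiouville.CircleStokes (deriv_circ_eq_vortCirc)
open Summit.NavierStokesRegularity.NavierStokesRegularity.Theorems.AveragedConeLiouville.CircMonotone
  (circ_zero vortCirc_zero vortCirc_nonneg circ_nonneg)
open Summit.NavierStokesRegularity.NavierStokesRegularity.Theorems.AveragedConeLiouville.FlatFlux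
  (eq_zero_of_signE3_globalCone_circ_eq_zero not_backwardSingular_of_signE3_globalCone_circ_eq_zero)
open Summit.NavierStokesRegularity.NavierStokesRegularity.Theorems.AveragedConeLiouville.ShellBookkeeping (cylRadius_cylPt)
open Summit.NavierStokesRegularity.NavierStokesRegularity.Theorems.HalfSpaceWindowDoorCirculationCarryingRigidityAxisCirculation
open Summit.NavierStokesRegularity.NavierStokesRegularity.Theorems.HalfSpaceWindowDoorCirculationCarryingRigidityAxisCirculationDynamics
open Summit.NavierStokesRegularity.NavierStokesRegularity.Theorems.HalfSpaceWindowDoorCirculationCarryingRigiditySourcedSwirlLiouville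

variable {C D K : ℝ} {v : ℝ → EuclideanSpace ℝ (Fin 3) → EuclideanSpace ℝ (Fin 3)}

/-! ### The extra radial drift: pointwise facts -/

/-- **The circle term is `β`-proportional to the vertical flux**, with `|β| ≤ (1+K)D/(r + √(−s))`: under the sign, the
circle-averaged cone (constant `K ≥ 0`) and the space–time Type-I bound, at every `s < 0` and every `x`,
`|T| ≤ (1+K)·D/(|x_h| + √(−s)) · ∮ω₃ dl` (both evaluated on the axis circle through `x`). -/
theorem abs_circleTerm_le_typeI (hsm : IsSmoothSpaceTimeOn (Iio (0 : ℝ)) v) (hD : HasTypeIDecay D v) (hsign : SignE3 v)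
    (hK : ∀ s < 0, ∀ r : ℝ, 0 ≤ r → ∀ z : ℝ, tiltCirc v r z s ≤ K * vortCirc v r z s) {s : ℝ} (hs : s < 0)
    (x : EuclideanSpace ℝ (Fin 3)) :
    |circleTerm v (cylRadius x) (x 2) s| ≤
      (1 + K) * (D / (cylRadius x + Real.sqrt (-s))) * vortCirc v (cylRadius x) (x 2) s := by
  have hv1 : ContDiff ℝ 1 (v s) := (hsm.contDiff_slice hs).of_le (by norm_cast)
  have hD0 : 0 ≤ D := typeIDecay_nonneg hD hs
  have hr := cylRadius_nonneg x
  have hB : ∀ θ : ℝ, ‖v s (cylPt (cylRadius x) θ (x 2))‖ ≤ D / (cylRadius x + Real.sqrt (-s)) :=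
    fun θ => norm_le_on_circle hD hs hr θ (x 2)
  have hsq : 0 < Real.sqrt (-s) := Real.sqrt_pos.2 (by linarith)
  exact abs_circleTerm_le_cone hv1 (fun y => hsign s hs y) hr hB (by positivity) (hK s hs (cylRadius x) hr (x 2))

/-! ### The sourced swirl equation for the axis circulation (fundamental theorem of calculus in time) -/

/-- **The time-integrated sourced swirl equation for `F = (2π)⁻¹Γ`** off the axis: for any coefficient `β` with
`β ∮ω₃ dl = T` (the circle term) at negative times, and `s ≤ t < 0`,
`F(t,x) − F(s,x) = ∫ₛᵗ (ΔF − DF[0] − (2/r + β) ∂ᵣF) dσ`. -/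
theorem circF_eqn (hrate : HasTypeITimeDecay C v)
    (hcont : ContinuousOn (uncurry v) (Iio (0 : ℝ) ×ˢ univ))
    (hmild : ∀ s t : ℝ, s < t → t < 0 → ∀ x,
      v t x = UnboundedOperators.heatExtension (v s) (t - s) x - oseenDuhamel 1 s v v t x)
    (hdiv : ∀ t < 0, VectorCalculus.IsDivFree (v t))
    {β : ℝ → EuclideanSpace ℝ (Fin 3) → ℝ}
    (hβT : ∀ s < 0, ∀ x : EuclideanSpace ℝ (Fin 3),
      β s x * vortCirc v (cylRadius x) (x 2) s = circleTerm v (cylRadius x) (x 2) s)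
    {x : EuclideanSpace ℝ (Fin 3)} (hx : cylRadius x ≠ 0) {s t : ℝ} (hst : s ≤ t) (ht : t < 0) :
    (2 * Real.pi)⁻¹ * circ v (cylRadius x) (x 2) t - (2 * Real.pi)⁻¹ * circ v (cylRadius x) (x 2) s =
      ∫ σ in s..t, ((Δ (fun y : EuclideanSpace ℝ (Fin 3) => (2 * Real.pi)⁻¹ * circ v (cylRadius y) (y 2) σ)) x
        - fderiv ℝ (fun y : EuclideanSpace ℝ (Fin 3) => (2 * Real.pi)⁻¹ * circ v (cylRadius y) (y 2) σ) x 0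
        - (2 / cylRadius x + β σ x) *
          partialDeriv (eR x) (fun y : EuclideanSpace ℝ (Fin 3) => (2 * Real.pi)⁻¹ * circ v (cylRadius y) (y 2) σ) x) := by
  have hsm : IsSmoothSpaceTimeOn (Iio (0 : ℝ)) v := isSmoothSpaceTimeOn_of_class hrate hcont hmild hdiv
  have hSF := isSmoothSpaceTimeOn_circF hsm
  have hr : 0 < cylRadius x := lt_of_le_of_ne (cylRadius_nonneg x) (Ne.symm hx)
  have hσneg : ∀ σ ∈ uIcc s t, σ < 0 := by
    intro σ hσ; rw [uIcc_of_le hst] at hσ; exact lt_of_le_of_lt hσ.2 ht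
  -- the continuous form of the integrand
  set H : ℝ → ℝ := fun σ =>
    (Δ (fun y : EuclideanSpace ℝ (Fin 3) => (2 * Real.pi)⁻¹ * circ v (cylRadius y) (y 2) σ)) x
      - 2 / cylRadius x * ((2 * Real.pi)⁻¹ * vortCirc v (cylRadius x) (x 2) σ)
      - (2 * Real.pi)⁻¹ * circleTerm v (cylRadius x) (x 2) σ with hH
  have hGH : ∀ σ, σ < 0 →
      (Δ (fun y : EuclideanSpace ℝ (Fin 3) => (2 * Real.pi)⁻¹ * circ v (cylRadius y) (y 2) σ)) x
        - fderiv ℝ (fun y : EuclideanSpace ℝ (Fin 3) => (2 * Real.pi)⁻¹ * circ v (cylRadius y) (y 2) σ) x 0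
        - (2 / cylRadius x + β σ x) *
          partialDeriv (eR x) (fun y : EuclideanSpace ℝ (Fin 3) => (2 * Real.pi)⁻¹ * circ v (cylRadius y) (y 2) σ) x
        = H σ := by
    intro σ hσ
    rw [hH, map_zero, partialDeriv_apply, fderiv_circF_eR hsm hσ x]
    have hb := hβT σ hσ x
    simp only
    have : β σ x * ((2 * Real.pi)⁻¹ * vortCirc v (cylRadius x) (x 2) σ) =
        (2 * Real.pi)⁻¹ * circleTerm v (cylRadius x) (x 2) σ := by
      rw [← hb]; ring
    rw [add_mul, this]
    ring
  -- continuity of `H` on `[s, t]`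
  have hIcc : MapsTo (fun σ : ℝ => ((cylRadius x, x 2, σ) : ℝ × ℝ × ℝ)) (uIcc s t) {q : ℝ × ℝ × ℝ | q.2.2 < 0} :=
    fun σ hσ => hσneg σ hσ
  have hcq : Continuous fun σ : ℝ => ((cylRadius x, x 2, σ) : ℝ × ℝ × ℝ) := by fun_prop
  have hIcc' : MapsTo (fun σ : ℝ => ((σ, x) : ℝ × EuclideanSpace ℝ (Fin 3))) (uIcc s t) (Iio (0 : ℝ) ×ˢ univ) :=
    fun σ hσ => ⟨hσneg σ hσ, mem_univ _⟩
  have hcσ : Continuous fun σ : ℝ => ((σ, x) : ℝ × EuclideanSpace ℝ (Fin 3)) := by fun_prop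
  have hHc : ContinuousOn H (uIcc s t) := by
    have h1 : ContinuousOn (fun σ =>
        (Δ (fun y : EuclideanSpace ℝ (Fin 3) => (2 * Real.pi)⁻¹ * circ v (cylRadius y) (y 2) σ)) x) (uIcc s t) := by
      have h := ((hSF.laplacian (uniqueDiffOn_Iio 0)).continuousOn).comp hcσ.continuousOn hIcc'
      simpa only [Function.comp_def, Function.uncurry_apply_pair] using h
    have h2 : ContinuousOn (fun σ => vortCirc v (cylRadius x) (x 2) σ) (uIcc s t) := by
      have h := (continuousOn_vortCirc hsm).comp hcq.continuousOn hIcc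
      simpa only [Function.comp_def] using h
    have h3 : ContinuousOn (fun σ => circleTerm v (cylRadius x) (x 2) σ) (uIcc s t) := by
      have h := (continuousOn_circleTerm hsm).comp hcq.continuousOn hIcc
      simpa only [Function.comp_def] using h
    exact (h1.sub (continuousOn_const.mul (continuousOn_const.mul h2))).sub (continuousOn_const.mul h3)
  -- the pointwise time derivative
  have hderiv : ∀ σ ∈ uIcc s t, HasDerivAt (fun σ' => (2 * Real.pi)⁻¹ * circ v (cylRadius x) (x 2) σ') (H σ) σ := by
    intro σ hσ
    have hσ0 := hσneg σ hσ
    have h := hasDerivAt_circF_time hsm hσ0 x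
    have hv1 : ContDiff ℝ 1 (v σ) := (hsm.contDiff_slice hσ0).of_le (by norm_cast)
    have hd := deriv_circ_s_eq hrate hcont hmild hdiv hσ0 hr (x 2)
    have hlap := laplacian_circF hsm hσ0 hx
    have hvr := deriv_circ_eq_vortCirc v hv1 (cylRadius x) (x 2)
    have e : (2 * Real.pi)⁻¹ * deriv (fun s' => circ v (cylRadius x) (x 2) s') σ = H σ := by
      rw [hH, hd]
      simp only
      rw [hlap, hvr]
      field_simp
      ring
    rw [← e]
    exact h
  have hint : IntervalIntegrable H volume s t := (hHc.mono le_rfl).intervalIntegrable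
  have hFTC := intervalIntegral.integral_eq_sub_of_hasDerivAt hderiv hint
  rw [← hFTC]
  refine intervalIntegral.integral_congr fun σ hσ => ?_
  exact (hGH σ (hσneg σ hσ)).symm

/-! ### The axis circulation of a tilt-dominated space–time Type-I profile is a sourced swirl triple -/

/-- **`(F, 0, β)` is a sourced swirl triple** with `C_f = D`, `C_u = 0`, `A = (1+K)D`, `τ = 0`, for
`F(s,x) = (2π)⁻¹Γ(|x_h|,x₃,s)` and any jointly measurable `β` with `β ∮ω₃ dl = T` and `|β| ≤ (1+K)D/(r+√(−s))` at every
`s < 0`. -/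
theorem isSourcedSwirl_circF (hrate : HasTypeITimeDecay C v)
    (hcont : ContinuousOn (uncurry v) (Iio (0 : ℝ) ×ˢ univ))
    (hmild : ∀ s t : ℝ, s < t → t < 0 → ∀ x,
      v t x = UnboundedOperators.heatExtension (v s) (t - s) x - oseenDuhamel 1 s v v t x)
    (hdiv : ∀ t < 0, VectorCalculus.IsDivFree (v t)) (hD : HasTypeIDecay D v) (hsign : SignE3 v) (hK0 : 0 ≤ K)
    {β : ℝ → EuclideanSpace ℝ (Fin 3) → ℝ} (hβm : Measurable (uncurry β))
    (hβT : ∀ s < 0, ∀ x : EuclideanSpace ℝ (Fin 3),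
      β s x * vortCirc v (cylRadius x) (x 2) s = circleTerm v (cylRadius x) (x 2) s)
    (hβle : ∀ s < 0, ∀ x : EuclideanSpace ℝ (Fin 3), |β s x| ≤ (1 + K) * (D / (cylRadius x + Real.sqrt (-s)))) :
    IsSourcedSwirl D 0 ((1 + K) * D) 0
      (fun s (x : EuclideanSpace ℝ (Fin 3)) => (2 * Real.pi)⁻¹ * circ v (cylRadius x) (x 2) s)
      (fun _ _ => 0) β := by
  have hsm : IsSmoothSpaceTimeOn (Iio (0 : ℝ)) v := isSmoothSpaceTimeOn_of_class hrate hcont hmild hdiv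
  have hD0 : 0 ≤ D := typeIDecay_nonneg hD (show (-1 : ℝ) < 0 by norm_num)
  have hSF := isSmoothSpaceTimeOn_circF hsm
  refine ⟨?_, ?_, ?_, ?_, ?_, ?_, ?_, ?_, ?_, ?_, ?_, hβm, by positivity, ?_, ?_, ?_⟩
  · intro t ht; exact contDiff_circF (hsm.contDiff_slice ht)
  · exact hSF.continuousOn_fderiv_slice (uniqueDiffOn_Iio 0)
  · exact (hSF.laplacian (uniqueDiffOn_Iio 0)).continuousOn
  · intro t _; exact isAxisymmetricScalar_circF v t
  · intro t _ x hx; exact circF_axis v t hx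
  · intro t ht x; exact abs_circF_le hD ht x
  · intro t ht x; exact fderiv_circF_eR_nonneg hsm hsign ht x
  · exact measurable_const
  · intro t _; exact contDiff_const
  · intro t _ x; simp [VectorCalculus.divergence]
  · intro t _ x; simp
  · intro t ht x
    have h := hβle t ht x
    have hsq : 0 < Real.sqrt (-t) := Real.sqrt_pos.2 (by linarith)
    have hr := cylRadius_nonneg x
    calc |β t x| * cylRadius x ≤ (1 + K) * (D / (cylRadius x + Real.sqrt (-t))) * cylRadius x :=
          mul_le_mul_of_nonneg_right h hr
      _ ≤ (1 + K) * D := by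
          rw [mul_assoc]
          refine mul_le_mul_of_nonneg_left ?_ (by positivity)
          rw [div_mul_eq_mul_div, div_le_iff₀ (by positivity)]
          nlinarith
  · intro t ht x
    have h := hβle t ht x
    have hsq : 0 < Real.sqrt (-t) := Real.sqrt_pos.2 (by linarith)
    have hr := cylRadius_nonneg x
    rw [zero_sub]
    calc |β t x| * Real.sqrt (-t) ≤ (1 + K) * (D / (cylRadius x + Real.sqrt (-t))) * Real.sqrt (-t) :=
          mul_le_mul_of_nonneg_right h hsq.le
      _ ≤ (1 + K) * D := by
          rw [mul_assoc]
          refine mul_le_mul_of_nonneg_left ?_ (by positivity)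
          rw [div_mul_eq_mul_div, div_le_iff₀ (by positivity)]
          nlinarith
  · intro x hx s t hst ht
    exact circF_eqn hrate hcont hmild hdiv hβT hx hst ht

/-! ### The census theorem -/

/-- **TILT-DOMINATED CLOSED-HEMISPHERE PROFILES OF THE SPACE–TIME TYPE-I SUBCLASS ARE TRIVIAL** (unconditional).  A profile
of the door's Type-I ancient Oseen-mild class with the space–time Type-I bound `‖v(t,x)‖ ≤ D/(‖x‖ + √(−t))`, the
closed-hemisphere sign `⟪curl v, e₃⟫ ≥ 0` and the slack-free circle-averaged cone about the vertical axis through the apex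
(`∮_{S(r,z)}|ω_h| dl ≤ K ∮_{S(r,z)} ω₃ dl`, all `r > 0`, `z`, `s < 0`) vanishes identically. -/
theorem eq_zero_of_hasTypeIDecay_signE3_globalCone (C D : ℝ) (v : ℝ → EuclideanSpace ℝ (Fin 3) → EuclideanSpace ℝ (Fin 3))
    (hrate : HasTypeITimeDecay C v)
    (hcont : ContinuousOn (uncurry v) (Iio (0 : ℝ) ×ˢ univ))
    (hmild : ∀ s t : ℝ, s < t → t < 0 → ∀ x,
      v t x = UnboundedOperators.heatExtension (v s) (t - s) x - oseenDuhamel 1 s v v t x)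
    (hdiv : ∀ t < 0, VectorCalculus.IsDivFree (v t)) (hD : HasTypeIDecay D v)
    (hsign : ∀ s < 0, ∀ y, 0 ≤ ⟪curl (v s) y, (EuclideanSpace.single (2 : Fin 3) (1 : ℝ))⟫_ℝ)
    (hcone : GlobalCone v) : ∀ t < 0, ∀ x, v t x = 0 := by
  have hsm : IsSmoothSpaceTimeOn (Iio (0 : ℝ)) v := isSmoothSpaceTimeOn_of_class hrate hcont hmild hdiv
  have hsign' : SignE3 v := hsign
  obtain ⟨K, hK0, hK⟩ := tiltCirc_le_of_globalCone hcone
  -- the extra radial drift `β = T / ∮ω₃` (zero off the slab), jointly measurable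
  set Slab : Set (ℝ × EuclideanSpace ℝ (Fin 3)) := {p | p.1 < 0} with hSlab
  have hSlabm : MeasurableSet Slab := measurableSet_lt measurable_fst measurable_const
  set Tf : ℝ × EuclideanSpace ℝ (Fin 3) → ℝ := fun p => circleTerm v (cylRadius p.2) (p.2 2) p.1 with hTf
  set Df : ℝ × EuclideanSpace ℝ (Fin 3) → ℝ := fun p => vortCirc v (cylRadius p.2) (p.2 2) p.1 with hDf
  have hq2 : Continuous fun p : ℝ × EuclideanSpace ℝ (Fin 3) => p.2 2 :=
    (PiLp.continuous_apply 2 (fun _ : Fin 3 => ℝ) (2 : Fin 3)).comp continuous_snd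
  have hq : Continuous fun p : ℝ × EuclideanSpace ℝ (Fin 3) => ((cylRadius p.2, p.2 2, p.1) : ℝ × ℝ × ℝ) :=
    (continuous_cylRadius.comp continuous_snd).prodMk (hq2.prodMk continuous_fst)
  have hmaps : MapsTo (fun p : ℝ × EuclideanSpace ℝ (Fin 3) => ((cylRadius p.2, p.2 2, p.1) : ℝ × ℝ × ℝ)) Slab
      {q : ℝ × ℝ × ℝ | q.2.2 < 0} := fun p hp => hp
  have hTc : ContinuousOn Tf Slab := by
    have h := (continuousOn_circleTerm hsm).comp hq.continuousOn hmaps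
    simpa only [Function.comp_def] using h
  have hDc : ContinuousOn Df Slab := by
    have h := (continuousOn_vortCirc hsm).comp hq.continuousOn hmaps
    simpa only [Function.comp_def] using h
  have hTm : Measurable (Slab.piecewise Tf 0) := hTc.measurable_piecewise continuousOn_const hSlabm
  have hDm : Measurable (Slab.piecewise Df 0) := hDc.measurable_piecewise continuousOn_const hSlabm
  set β : ℝ → EuclideanSpace ℝ (Fin 3) → ℝ := fun s x => Slab.piecewise Tf 0 (s, x) / Slab.piecewise Df 0 (s, x) with hβ
  have hβm : Measurable (uncurry β) := by
    have e : uncurry β = fun p => Slab.piecewise Tf 0 p / Slab.piecewise Df 0 p := by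
      funext p; rfl
    rw [e]; exact hTm.div hDm
  have hβval : ∀ s < 0, ∀ x : EuclideanSpace ℝ (Fin 3),
      β s x = circleTerm v (cylRadius x) (x 2) s / vortCirc v (cylRadius x) (x 2) s := by
    intro s hs x
    have hmem : ((s, x) : ℝ × EuclideanSpace ℝ (Fin 3)) ∈ Slab := hs
    show Slab.piecewise Tf 0 (s, x) / Slab.piecewise Df 0 (s, x) = _
    rw [Set.piecewise_eq_of_mem _ _ _ hmem, Set.piecewise_eq_of_mem _ _ _ hmem]
  -- pointwise: `β ∮ω₃ = T` and `|β| ≤ (1+K) D/(r+√(−s))`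
  have hT : ∀ s < 0, ∀ x : EuclideanSpace ℝ (Fin 3), |circleTerm v (cylRadius x) (x 2) s| ≤
      (1 + K) * (D / (cylRadius x + Real.sqrt (-s))) * vortCirc v (cylRadius x) (x 2) s :=
    fun s hs x => abs_circleTerm_le_typeI hsm hD hsign' hK hs x
  have hvort : ∀ s < 0, ∀ x : EuclideanSpace ℝ (Fin 3), 0 ≤ vortCirc v (cylRadius x) (x 2) s :=
    fun s hs x => vortCirc_nonneg v hsign' hs (cylRadius_nonneg x) _
  have hβT : ∀ s < 0, ∀ x : EuclideanSpace ℝ (Fin 3),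
      β s x * vortCirc v (cylRadius x) (x 2) s = circleTerm v (cylRadius x) (x 2) s := by
    intro s hs x
    rw [hβval s hs x]
    by_cases h0 : vortCirc v (cylRadius x) (x 2) s = 0
    · have h := hT s hs x
      rw [h0, mul_zero] at h
      rw [h0, mul_zero, eq_comm]
      exact abs_nonpos_iff.1 h
    · field_simp
  have hβle : ∀ s < 0, ∀ x : EuclideanSpace ℝ (Fin 3), |β s x| ≤ (1 + K) * (D / (cylRadius x + Real.sqrt (-s))) := by
    intro s hs x
    have hD0 : 0 ≤ D := typeIDecay_nonneg hD hs
    have hsq : 0 < Real.sqrt (-s) := Real.sqrt_pos.2 (by linarith)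
    have hnn : 0 ≤ (1 + K) * (D / (cylRadius x + Real.sqrt (-s))) := by
      have := cylRadius_nonneg x; positivity
    rw [hβval s hs x]
    by_cases h0 : vortCirc v (cylRadius x) (x 2) s = 0
    · rw [h0, div_zero, abs_zero]; exact hnn
    have hpos : 0 < vortCirc v (cylRadius x) (x 2) s := lt_of_le_of_ne (hvort s hs x) (Ne.symm h0)
    rw [abs_div, abs_of_pos hpos, div_le_iff₀ hpos]
    exact hT s hs x
  -- the sourced swirl triple and its Liouville theorem: `F ≡ 0`
  have hS := isSourcedSwirl_circF hrate hcont hmild hdiv hD hsign' hK0 hβm hβT hβle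
  have hFnn : ∀ t < 0, ∀ x : EuclideanSpace ℝ (Fin 3), 0 ≤ (2 * Real.pi)⁻¹ * circ v (cylRadius x) (x 2) t := by
    intro t ht x
    have hv1 : ContDiff ℝ 1 (v t) := (hsm.contDiff_slice ht).of_le (by norm_cast)
    exact mul_nonneg (by positivity) (circ_nonneg (v := v) hv1 hsign' ht (cylRadius_nonneg x) _)
  have hF0 := IsSourcedSwirl.eq_zero_of_nonneg hS hFnn
  -- `Γ ≡ 0` on the apex window of the slice `s = -1`, hence `v ≡ 0`
  refine eq_zero_of_signE3_globalCone_circ_eq_zero hrate hcont hmild hdiv hsign' hcone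
    (show (-1 : ℝ) < 0 by norm_num) one_pos fun r hr z _ => ?_
  have h := hF0 (-1) (by norm_num) (cylPt r 0 z)
  rw [cylRadius_cylPt hr.1.le] at h
  have hz : (cylPt r 0 z) 2 = z := by simp [cylPt]
  rw [hz] at h
  have hπ : (2 * Real.pi)⁻¹ ≠ 0 := by positivity
  exact (mul_eq_zero.1 h).resolve_left hπ

/-- **Corollary (the crux's vocabulary)**: such a profile is poloidal, `⟪curl v, e₃⟫ ≡ 0` — the conclusion of the open stub
`HemisphereLiouvilleE3` on this stratum. -/
theorem inner_curl_e3_eq_zero_of_hasTypeIDecay_globalCone (C D : ℝ)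
    (v : ℝ → EuclideanSpace ℝ (Fin 3) → EuclideanSpace ℝ (Fin 3))
    (hrate : HasTypeITimeDecay C v)
    (hcont : ContinuousOn (uncurry v) (Iio (0 : ℝ) ×ˢ univ))
    (hmild : ∀ s t : ℝ, s < t → t < 0 → ∀ x,
      v t x = UnboundedOperators.heatExtension (v s) (t - s) x - oseenDuhamel 1 s v v t x)
    (hdiv : ∀ t < 0, VectorCalculus.IsDivFree (v t)) (hD : HasTypeIDecay D v)
    (hsign : ∀ s < 0, ∀ y, 0 ≤ ⟪curl (v s) y, (EuclideanSpace.single (2 : Fin 3) (1 : ℝ))⟫_ℝ)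
    (hcone : GlobalCone v) : ∀ s < 0, ∀ y, ⟪curl (v s) y, (EuclideanSpace.single (2 : Fin 3) (1 : ℝ))⟫_ℝ = 0 := by
  intro s hs y
  have h0 := eq_zero_of_hasTypeIDecay_signE3_globalCone C D v hrate hcont hmild hdiv hD hsign hcone
  have hvs : v s = fun _ => 0 := funext fun x => h0 s hs x
  have hcurl : curl (v s) y = 0 := by
    rw [hvs]
    ext i
    fin_cases i <;> simp [curl]
  rw [hcurl, inner_zero_left]

/-- **Corollary (the door's conclusion)**: such a profile is not backward singular at the apex. -/
theorem not_backwardSingular_of_hasTypeIDecay_globalCone (C D : ℝ)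
    (v : ℝ → EuclideanSpace ℝ (Fin 3) → EuclideanSpace ℝ (Fin 3))
    (hrate : HasTypeITimeDecay C v)
    (hcont : ContinuousOn (uncurry v) (Iio (0 : ℝ) ×ˢ univ))
    (hmild : ∀ s t : ℝ, s < t → t < 0 → ∀ x,
      v t x = UnboundedOperators.heatExtension (v s) (t - s) x - oseenDuhamel 1 s v v t x)
    (hdiv : ∀ t < 0, VectorCalculus.IsDivFree (v t)) (hD : HasTypeIDecay D v)
    (hsign : ∀ s < 0, ∀ y, 0 ≤ ⟪curl (v s) y, (EuclideanSpace.single (2 : Fin 3) (1 : ℝ))⟫_ℝ)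
    (hcone : GlobalCone v) : ¬ IsBackwardSingularPoint v 0 :=
  Summit.NavierStokesRegularity.NavierStokesRegularity.Theorems.PoloidalWindowDoorPoloidalWindowRigidityFlat.not_backwardSingular_of_zero
    (eq_zero_of_hasTypeIDecay_signE3_globalCone C D v hrate hcont hmild hdiv hD hsign hcone)

end Summit.NavierStokesRegularity.NavierStokesRegularity.Theorems.HalfSpaceWindowDoorCirculationCarryingRigidityTiltDominatedLiouville

end
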